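import Literature.Analysis.FunctionSpaces.LatticeConvolution
import Literature.Analysis.FunctionSpaces.LatticeSobolevDeriv
import Mathlib.Algebra.Ring.GeomSum
import HarnessLib

/-!
# Convolution operators on the lattice Sobolev scale, III: the commutator with the weights
# `⟨k⟩^{-σ}` and the Peter–Paul inequality (Warner 6.18 (g), (i) for negative order)

Continuation of `LatticeConvolution.lean`. Warner (GTM 94 (1983), 6.18 (i), (6)) proves the sharp
multiplication estimate `‖ωφ‖_s ≤ c‖ω‖_∞‖φ‖_s + c'‖φ‖_{s-1}`; for `s < 0` his proof ((15)–(17))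
commutes `ω` past the isometries `K^s : H_s → H_{-s}` and controls the commutator, an operator of
order `-2s - 1` in his normalisation. On the lattice the same mechanism is the commutator of the
convolution `a ⋆ ·` with the **weight multiplier** `Λ^s c = ⟨k⟩^s • c` (`Lattice.wmul`), whose
kernel is `(⟨k⟩^s - ⟨l⟩^s) a(k-l)`. For `s = -σ ≤ 0`, `σ ∈ ℕ`, the elementary bound

  `|⟨k⟩^{-σ} - ⟨l⟩^{-σ}| ≤ σ 2^{(σ+1)/2} ⟨k-l⟩^{σ+2} ⟨l⟩^{-σ-1}`      (`Torus.abs_sobolevWeight_neg_sub_le`)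

(mean-value estimate for `t ↦ t^{-σ}` on `[1, ∞)` plus Peetre) makes the commutator an operator
of order `s - 1`:

  `‖Λ^s(a ⋆ g) - a ⋆ (Λ^s g)‖_0 ≤ σ 2^{(σ+1)/2} A_{σ+2}(a) ‖g‖_{s-1}`   (`Lattice.eNorm_wmul_conv_sub_le`).

Consequently an `H_0 → H_0` bound `‖a ⋆ c‖_0 ≤ ε‖c‖_0` for the multiplier (which the torus side
supplies from `‖ω‖_∞ ≤ ε`, Parseval) transfers to the negative levels used by the elliptic
estimates: `‖a ⋆ g‖_{-σ} ≤ ε ‖g‖_{-σ} + σ2^{(σ+1)/2}A_{σ+2}(a) ‖g‖_{-σ-1}`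
(`Lattice.eNorm_conv_le_of_level_zero`) — Warner's (6) for `s < 0`.

Also here: the **Peter–Paul inequality** (Warner 6.18 (g)) in the form
`‖c‖²_{s+1} ≤ δ ‖c‖²_{s+2} + (4δ)⁻¹ ‖c‖²_s`.

## References

* F. W. Warner, *Foundations of Differentiable Manifolds and Lie Groups*, GTM 94 (1983), 6.18 (g),
  (i) and its proof (15)–(17). [WarnerGTM94]
-/

open Filter Finset
open scoped ENNReal NNReal Topology

noncomputable section

namespace Literature.Analysis.FunctionSpaces

/-! ### The kernel bound `|⟨k⟩^{-σ} - ⟨l⟩^{-σ}|` -/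

namespace Torus

variable {d : Type*} [Fintype d]

/-- Mean-value estimate for `t ↦ t^{-σ}` on `[1, ∞)`: for `1 ≤ y ≤ x` and `σ ∈ ℕ`,
`y^{-σ} - x^{-σ} ≤ σ (x - y) y^{-σ-1}` (from `x^σ - y^σ = (x-y)∑ xⁱ y^{σ-1-i} ≤ σ(x-y)x^{σ-1}`).
[folklore] -/
theorem inv_pow_sub_inv_pow_le {x y : ℝ} (hy : 1 ≤ y) (hxy : y ≤ x) (σ : ℕ) :
    (y ^ σ)⁻¹ - (x ^ σ)⁻¹ ≤ σ * (x - y) * (y ^ (σ + 1))⁻¹ := by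
  have hx : 1 ≤ x := hy.trans hxy
  have hypos : 0 < y := by linarith
  have hxpos : 0 < x := by linarith
  have hS : ∑ i ∈ range σ, x ^ i * y ^ (σ - 1 - i) ≤ σ * x ^ (σ - 1) := by
    calc ∑ i ∈ range σ, x ^ i * y ^ (σ - 1 - i) ≤ ∑ i ∈ range σ, x ^ (σ - 1) := by
          refine sum_le_sum fun i hi => ?_
          have hi' : i ≤ σ - 1 := Nat.le_sub_one_of_lt (mem_range.1 hi)
          calc x ^ i * y ^ (σ - 1 - i) ≤ x ^ i * x ^ (σ - 1 - i) := by gcongr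
            _ = x ^ (σ - 1) := by rw [← pow_add, Nat.add_sub_cancel' hi']
      _ = σ * x ^ (σ - 1) := by rw [sum_const, card_range, nsmul_eq_mul]
  have hgeom : x ^ σ - y ^ σ ≤ σ * (x - y) * x ^ (σ - 1) := by
    calc x ^ σ - y ^ σ = (∑ i ∈ range σ, x ^ i * y ^ (σ - 1 - i)) * (x - y) := (geom_sum₂_mul x y σ).symm
      _ ≤ (σ * x ^ (σ - 1)) * (x - y) := mul_le_mul_of_nonneg_right hS (by linarith)
      _ = σ * (x - y) * x ^ (σ - 1) := by ring
  rcases Nat.eq_zero_or_pos σ with rfl | hσ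
  · simp
  -- divide `x^σ - y^σ ≤ σ (x-y) x^{σ-1}` by `x^σ y^σ` and use `x^{σ-1}/x^σ = 1/x ≤ 1/y`
  have hxs : x ^ σ = x ^ (σ - 1) * x := by rw [← pow_succ, Nat.sub_add_cancel hσ]
  rw [inv_sub_inv (by positivity) (by positivity), div_le_iff₀ (by positivity)]
  calc x ^ σ - y ^ σ ≤ σ * (x - y) * x ^ (σ - 1) := hgeom
    _ ≤ σ * (x - y) * x ^ (σ - 1) * (x / y) := by
        refine le_mul_of_one_le_right (by positivity [sub_nonneg.2 hxy]) ?_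
        rwa [one_le_div hypos]
    _ = σ * (x - y) * (y ^ (σ + 1))⁻¹ * (y ^ σ * x ^ σ) := by
        rw [hxs]; field_simp; ring

/-- `|⟨k⟩ - ⟨l⟩| ≤ ⟨k - l⟩`: the Japanese bracket `⟨k⟩ = |(1, k)|` is `1`-Lipschitz for the
Euclidean length, and `|k - l| ≤ ⟨k - l⟩`. [folklore] -/
theorem abs_sobolevWeight_one_sub_le (k l : d → ℤ) :
    |sobolevWeight 1 k - sobolevWeight 1 l| ≤ sobolevWeight 1 (k - l) := by
  -- `⟨k⟩ = ‖(1, (k_i))‖` in `ℝ × EuclideanSpace`: use `WithLp`-free elementary route via squares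
  have hk := sobolevWeight_pos 1 k
  have hl := sobolevWeight_pos 1 l
  have hkl := sobolevWeight_pos 1 (k - l)
  -- it suffices: `⟨k⟩ ≤ ⟨l⟩ + ⟨k-l⟩` and symmetrically
  have key : ∀ k l : d → ℤ, sobolevWeight 1 k ≤ sobolevWeight 1 l + sobolevWeight 1 (k - l) := by
    intro k l
    have hl := sobolevWeight_pos 1 l
    have hkl := sobolevWeight_pos 1 (k - l)
    rw [← abs_of_pos (sobolevWeight_pos 1 k), ← abs_of_pos (add_pos hl hkl), ← sq_le_sq,
      add_sq, sobolevWeight_one_sq, sobolevWeight_one_sq, sobolevWeight_one_sq]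
    -- `1 + |k|² ≤ (1+|l|²) + 2⟨l⟩⟨k-l⟩ + (1 + |k-l|²)`; Cauchy–Schwarz `k·? `: use
    -- `|k|² = |l + (k-l)|² ≤ |l|² + 2|l||k-l| + |k-l|²` and `|l| ≤ ⟨l⟩`, `|k-l| ≤ ⟨k-l⟩`
    have hCS : freqNormSq k ≤ freqNormSq l + 2 * (sobolevWeight 1 l * sobolevWeight 1 (k - l)) +
        freqNormSq (k - l) := by
      -- Cauchy–Schwarz for the finite sum `∑ l_i (k-l)_i ≤ √(∑ l_i²) √(∑ (k-l)_i²) ≤ ⟨l⟩⟨k-l⟩`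
      have h1 : ∑ i, (l i : ℝ) * ((k i : ℝ) - l i) ≤
          Real.sqrt (freqNormSq l) * Real.sqrt (freqNormSq (k - l)) := by
        have := Real.sum_mul_le_sqrt_mul_sqrt univ (fun i => (l i : ℝ)) (fun i => (k i : ℝ) - l i)
        simpa [freqNormSq, Pi.sub_apply, Int.cast_sub] using this
      have h2 : Real.sqrt (freqNormSq l) ≤ sobolevWeight 1 l := by
        rw [sobolevWeight, ← Real.sqrt_eq_rpow]
        exact Real.sqrt_le_sqrt (by linarith)
      have h3 : Real.sqrt (freqNormSq (k - l)) ≤ sobolevWeight 1 (k - l) := by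
        rw [sobolevWeight, ← Real.sqrt_eq_rpow]
        exact Real.sqrt_le_sqrt (by linarith)
      have h4 : ∑ i, (l i : ℝ) * ((k i : ℝ) - l i) ≤ sobolevWeight 1 l * sobolevWeight 1 (k - l) :=
        h1.trans (mul_le_mul h2 h3 (Real.sqrt_nonneg _) hl.le)
      have hexp : freqNormSq k = freqNormSq l + 2 * ∑ i, (l i : ℝ) * ((k i : ℝ) - l i) +
          freqNormSq (k - l) := by
        simp only [freqNormSq, Pi.sub_apply, Int.cast_sub, mul_sum, ← sum_add_distrib]
        exact sum_congr rfl fun i _ => by ring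
      linarith
    nlinarith [freqNormSq_nonneg (k - l)]
  rw [abs_sub_le_iff]
  constructor
  · linarith [key k l]
  · have := key l k
    rw [show sobolevWeight 1 (l - k) = sobolevWeight 1 (k - l) by
      rw [sobolevWeight, sobolevWeight, freqNormSq_sub_comm]] at this
    linarith

/-- `⟨k⟩^{-σ} = (⟨k⟩^σ)⁻¹` with a natural power. [folklore] -/
theorem sobolevWeight_neg_natCast (σ : ℕ) (k : d → ℤ) :
    sobolevWeight (-(σ : ℝ)) k = (sobolevWeight 1 k ^ σ)⁻¹ := by
  rw [sobolevWeight_neg, sobolevWeight, sobolevWeight, ← Real.rpow_natCast,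
    ← Real.rpow_mul (by linarith [freqNormSq_nonneg k])]
  congr 1; ring_nf

/-- **The commutator kernel bound**: for `σ ∈ ℕ`,
`|⟨k⟩^{-σ} - ⟨l⟩^{-σ}| ≤ σ 2^{(σ+1)/2} ⟨k-l⟩^{σ+2} ⟨l⟩^{-σ} ⟨l⟩^{-1}`
(mean-value bound at `min(⟨k⟩,⟨l⟩)`, `|⟨k⟩ - ⟨l⟩| ≤ ⟨k-l⟩`, and Peetre
`⟨k⟩^{-1} ≤ 2^{1/2}⟨k-l⟩⟨l⟩^{-1}` to replace `min` by `⟨l⟩`). This is the kernel of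
`[Λ^{-σ}, a ⋆]`, an operator of order `-σ - 1` (Warner 6.18, proof of (i), (17)).
[cite: WarnerGTM94, 6.18 (17)] -/
theorem abs_sobolevWeight_neg_sub_le (σ : ℕ) (k l : d → ℤ) :
    |sobolevWeight (-(σ : ℝ)) k - sobolevWeight (-(σ : ℝ)) l| ≤
      σ * (2 : ℝ) ^ (((σ : ℝ) + 1) / 2) * sobolevWeight ((σ : ℝ) + 2) (k - l) *
        (sobolevWeight (-(σ : ℝ)) l * sobolevWeight (-1) l) := by
  set x := sobolevWeight 1 k with hx
  set y := sobolevWeight 1 l with hy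
  have hx1 : 1 ≤ x := one_le_sobolevWeight zero_le_one k
  have hy1 : 1 ≤ y := one_le_sobolevWeight zero_le_one l
  have hD := abs_sobolevWeight_one_sub_le k l
  rw [sobolevWeight_neg_natCast, sobolevWeight_neg_natCast, sobolevWeight_neg, ← hx, ← hy]
  have hw2 : sobolevWeight ((σ : ℝ) + 2) (k - l) = sobolevWeight 1 (k - l) ^ (σ + 2) := by
    rw [sobolevWeight, sobolevWeight, ← Real.rpow_natCast,
      ← Real.rpow_mul (by linarith [freqNormSq_nonneg (k - l)])]
    congr 1; push_cast; ring
  rw [hw2]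
  set z := sobolevWeight 1 (k - l) with hz
  have hz1 : 1 ≤ z := one_le_sobolevWeight zero_le_one (k - l)
  -- Peetre at order `-1`: `min(x,y)⁻¹ ≤ √2 z / y`-type bounds: `x⁻¹ ≤ 2^{1/2} z y⁻¹`
  have hP : x⁻¹ ≤ (2 : ℝ) ^ ((1 : ℝ) / 2) * z * y⁻¹ := by
    have h := sobolevWeight_le_peetre (-1) k l
    rw [abs_neg, abs_one, sobolevWeight_neg, sobolevWeight_neg] at h
    exact h
  rcases le_total y x with hyx | hxy
  · -- `0 ≤ y^{-σ} - x^{-σ} ≤ σ (x - y) y^{-σ-1} ≤ σ z y^{-σ-1}`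
    rw [abs_sub_comm, abs_of_nonneg (sub_nonneg.2 (inv_anti₀ (by positivity) (pow_le_pow_left₀ (by linarith) hyx σ)))]
    calc (y ^ σ)⁻¹ - (x ^ σ)⁻¹ ≤ σ * (x - y) * (y ^ (σ + 1))⁻¹ := inv_pow_sub_inv_pow_le hy1 hyx σ
      _ ≤ σ * z * (y ^ (σ + 1))⁻¹ := by
          gcongr
          exact le_trans (le_abs_self _) hD
      _ ≤ σ * ((2 : ℝ) ^ (((σ : ℝ) + 1) / 2) * z ^ (σ + 2)) * (y ^ (σ + 1))⁻¹ := by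
          gcongr
          calc z = 1 * z ^ 1 := by ring
            _ ≤ (2 : ℝ) ^ (((σ : ℝ) + 1) / 2) * z ^ (σ + 2) :=
                mul_le_mul (Real.one_le_rpow (by norm_num) (by positivity))
                  (pow_le_pow_right₀ hz1 (by omega)) (by positivity) (by positivity)
      _ = _ := by rw [pow_succ]; ring
  · -- `0 ≤ x^{-σ} - y^{-σ} ≤ σ (y - x) x^{-σ-1}` and `x⁻¹ ≤ √2 z y⁻¹`
    rw [abs_of_nonneg (sub_nonneg.2 (inv_anti₀ (by positivity) (pow_le_pow_left₀ (by linarith) hxy σ)))]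
    calc (x ^ σ)⁻¹ - (y ^ σ)⁻¹ ≤ σ * (y - x) * (x ^ (σ + 1))⁻¹ := inv_pow_sub_inv_pow_le hx1 hxy σ
      _ ≤ σ * z * ((2 : ℝ) ^ ((1 : ℝ) / 2) * z * y⁻¹) ^ (σ + 1) := by
          rw [← inv_pow]
          gcongr
          · rw [abs_sub_comm] at hD; exact le_trans (le_abs_self _) hD
      _ = σ * ((2 : ℝ) ^ ((1 : ℝ) / 2)) ^ (σ + 1) * z ^ (σ + 2) * (y ^ (σ + 1))⁻¹ := by
          rw [mul_pow, mul_pow, inv_pow]; ring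
      _ = _ := by
          rw [← Real.rpow_natCast ((2 : ℝ) ^ ((1 : ℝ) / 2)), ← Real.rpow_mul (by norm_num), pow_succ y]
          push_cast
          ring_nf

end Torus

namespace Lattice

open Torus

variable {d : Type*} [Fintype d]
variable {V W : Type*} [NormedAddCommGroup V] [NormedSpace ℂ V] [NormedAddCommGroup W]
  [NormedSpace ℂ W]

/-! ### The weight multipliers `Λ^s` -/

/-- The **weight multiplier** `Λ^s`: `(Λ^s c)(k) = ⟨k⟩^s • c k`, the lattice form of Warner's
isometries `K^{s/2} : H_t → H_{t-s}` (6.18 (d)). [cite: WarnerGTM94, 6.18 (d)] -/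
def wmul (s : ℝ) (c : (d → ℤ) → V) : (d → ℤ) → V := fun k => (sobolevWeight s k : ℂ) • c k

/-- Unfolding of `wmul`. [folklore] -/
@[simp] theorem wmul_apply (s : ℝ) (c : (d → ℤ) → V) (k : d → ℤ) :
    wmul s c k = (sobolevWeight s k : ℂ) • c k := rfl

/-- `‖(Λ^s c)(k)‖ = ⟨k⟩^s ‖c k‖`. [folklore] -/
theorem norm_wmul_apply (s : ℝ) (c : (d → ℤ) → V) (k : d → ℤ) :
    ‖wmul s c k‖ = sobolevWeight s k * ‖c k‖ := by
  rw [wmul_apply, norm_smul, Complex.norm_real, Real.norm_of_nonneg (sobolevWeight_pos s k).le]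

/-- **`Λ^s` is an isometry `H_{t+s} → H_t`**: `‖Λ^s c‖²_t = ‖c‖²_{t+s}` (Warner 6.18 (d), (3)).
[cite: WarnerGTM94, 6.18 (d)] -/
@[simp] theorem eNormSq_wmul (t s : ℝ) (c : (d → ℤ) → V) : eNormSq t (wmul s c) = eNormSq (t + s) c := by
  refine tsum_congr fun k => ?_
  rw [← ofReal_norm, norm_wmul_apply, ENNReal.ofReal_mul (sobolevWeight_pos _ _).le, mul_pow,
    ← mul_assoc, ← ENNReal.ofReal_pow (sobolevWeight_pos _ _).le, ← ENNReal.ofReal_mul (sq_nonneg _),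
    ← mul_pow, sobolevWeight_add, ofReal_norm]

/-- `‖Λ^s c‖_t = ‖c‖_{t+s}`. [cite: WarnerGTM94, 6.18 (d)] -/
@[simp] theorem eNorm_wmul (t s : ℝ) (c : (d → ℤ) → V) : eNorm t (wmul s c) = eNorm (t + s) c := by
  rw [eNorm, eNormSq_wmul, eNorm]

/-- `Λ^s` of a tempered family is tempered. [folklore] -/
theorem Tempered.wmul {c : (d → ℤ) → V} (hc : Tempered c) (s : ℝ) : Tempered (wmul s c) := by
  obtain ⟨t, ht⟩ := hc
  exact ⟨t - s, by rwa [eNormSq_wmul, sub_add_cancel]⟩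

/-- `Λ^s Λ^{s'} = Λ^{s+s'}`. [folklore] -/
theorem wmul_wmul (s s' : ℝ) (c : (d → ℤ) → V) : wmul s (wmul s' c) = wmul (s + s') c := by
  funext k
  rw [wmul_apply, wmul_apply, wmul_apply, smul_smul, ← Complex.ofReal_mul, ← sobolevWeight_add]

/-- `Λ^0 = id`. [folklore] -/
@[simp] theorem wmul_zero (c : (d → ℤ) → V) : wmul 0 c = c := by
  funext k; simp

/-! ### The commutator `[Λ^{-σ}, a ⋆]` is of order `-σ - 1` -/

/-- The commutator, termwise: `(Λ^s (a ⋆ g) - a ⋆ (Λ^s g))(k) = ∑_l (⟨k⟩^s - ⟨l⟩^s) a(k-l)(g l)`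
for rapidly decreasing `a` and tempered `g`. [folklore] -/
theorem wmul_conv_sub_conv_wmul_apply [CompleteSpace W] {a : (d → ℤ) → (V →L[ℂ] W)}
    (ha : RapidDecay a) {g : (d → ℤ) → V} (hg : Tempered g) (s : ℝ) (k : d → ℤ) :
    (wmul s (conv a g) - conv a (wmul s g)) k =
      ∑' l, ((sobolevWeight s k - sobolevWeight s l : ℝ) : ℂ) • a (k - l) (g l) := by
  have h1 := summable_conv_term ha hg k
  have h2 := summable_conv_term ha (hg.wmul s) k
  simp only [Pi.sub_apply, wmul_apply, conv_apply] at h2 ⊢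
  rw [← h1.tsum_const_smul (sobolevWeight s k : ℂ), ← (h1.const_smul _).tsum_sub h2]
  refine tsum_congr fun l => ?_
  rw [map_smul, Complex.ofReal_sub, sub_smul]

/-- **The commutator `[Λ^{-σ}, a ⋆]` is an operator of order `-σ-1`** (Warner (1983), proof of
6.18 (i), (17): the commutator of `ω` with `K^{-s}` "only contains derivatives of `φ` up to order"
one less): for `σ ∈ ℕ`, rapidly decreasing `a` and tempered `g`,
`‖Λ^{-σ}(a ⋆ g) - a ⋆ (Λ^{-σ} g)‖_0 ≤ σ 2^{(σ+1)/2} A_{σ+2}(a) ‖g‖_{-σ-1}`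
(kernel bound `Torus.abs_sobolevWeight_neg_sub_le` and Young's inequality).
[cite: WarnerGTM94, 6.18 (17)] -/
theorem eNorm_wmul_conv_sub_le [CompleteSpace W] {a : (d → ℤ) → (V →L[ℂ] W)} (ha : RapidDecay a)
    {g : (d → ℤ) → V} (hg : Tempered g) (σ : ℕ) :
    eNorm 0 (wmul (-(σ : ℝ)) (conv a g) - conv a (wmul (-(σ : ℝ)) g)) ≤
      ENNReal.ofReal (σ * (2 : ℝ) ^ (((σ : ℝ) + 1) / 2)) * symbNorm ((σ : ℝ) + 2) a *
        eNorm (-(σ : ℝ) - 1) g := by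
  set C : ℝ := σ * (2 : ℝ) ^ (((σ : ℝ) + 1) / 2) with hC
  have hC0 : 0 ≤ C := by positivity
  -- the two `ℝ≥0∞`-valued families entering Young's inequality
  obtain ⟨α, hα⟩ : ∃ α : (d → ℤ) → ℝ≥0∞, ∀ k, α k = ENNReal.ofReal (sobolevWeight ((σ : ℝ) + 2) k * ‖a k‖) :=
    ⟨_, fun _ => rfl⟩
  obtain ⟨β, hβ⟩ : ∃ β : (d → ℤ) → ℝ≥0∞, ∀ l, β l = ENNReal.ofReal (sobolevWeight (-(σ : ℝ) - 1) l * ‖g l‖) :=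
    ⟨_, fun _ => rfl⟩
  have hww : ∀ l : d → ℤ, sobolevWeight (-(σ : ℝ)) l * sobolevWeight (-1) l = sobolevWeight (-(σ : ℝ) - 1) l :=
    fun l => by rw [show -(σ : ℝ) - 1 = -(σ : ℝ) + -1 by ring, sobolevWeight_add]
  -- termwise bound
  have hterm : ∀ k, ‖(wmul (-(σ : ℝ)) (conv a g) - conv a (wmul (-(σ : ℝ)) g)) k‖ₑ ≤
      ENNReal.ofReal C * ∑' l, α (k - l) * β l := fun k => by
    rw [wmul_conv_sub_conv_wmul_apply ha hg]
    refine enorm_tsum_le_tsum_enorm.trans ?_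
    rw [← ENNReal.tsum_mul_left]
    refine ENNReal.tsum_le_tsum fun l => ?_
    rw [enorm_smul, ← ofReal_norm, ← ofReal_norm (a (k - l) (g l)), Complex.norm_real, Real.norm_eq_abs]
    have hb := abs_sobolevWeight_neg_sub_le σ k l
    have hA0 : 0 ≤ sobolevWeight ((σ : ℝ) + 2) (k - l) * ‖a (k - l)‖ := by
      positivity [sobolevWeight_pos ((σ : ℝ) + 2) (k - l)]
    have h1 : 0 ≤ C * sobolevWeight ((σ : ℝ) + 2) (k - l) * (sobolevWeight (-(σ : ℝ)) l * sobolevWeight (-1) l) := by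
      positivity [sobolevWeight_pos ((σ : ℝ) + 2) (k - l), sobolevWeight_pos (-(σ : ℝ)) l, sobolevWeight_pos (-1) l]
    calc ENNReal.ofReal |sobolevWeight (-(σ : ℝ)) k - sobolevWeight (-(σ : ℝ)) l| * ENNReal.ofReal ‖a (k - l) (g l)‖
        ≤ ENNReal.ofReal (C * sobolevWeight ((σ : ℝ) + 2) (k - l) *
            (sobolevWeight (-(σ : ℝ)) l * sobolevWeight (-1) l)) * ENNReal.ofReal (‖a (k - l)‖ * ‖g l‖) :=
          mul_le_mul' (ENNReal.ofReal_le_ofReal hb) (ENNReal.ofReal_le_ofReal ((a (k - l)).le_opNorm _))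
      _ = ENNReal.ofReal C * (α (k - l) * β l) := by
          rw [hα, hβ, ← ENNReal.ofReal_mul hA0, ← ENNReal.ofReal_mul hC0, ← ENNReal.ofReal_mul h1, ← hww]
          congr 1
          ring
  -- identify `∑ α` and `∑ β²`
  have hαsum : ∑' k, α k = symbNorm ((σ : ℝ) + 2) a := tsum_congr fun k => by
    rw [hα, ENNReal.ofReal_mul (sobolevWeight_pos _ _).le, ofReal_norm]
  have hβsum : ∑' l, β l ^ 2 = eNormSq (-(σ : ℝ) - 1) g := tsum_congr fun l => by
    rw [hβ, ← ENNReal.ofReal_pow (by positivity [sobolevWeight_pos (-(σ : ℝ) - 1) l]), mul_pow,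
      ENNReal.ofReal_mul (sq_nonneg _), ← ofReal_norm, ENNReal.ofReal_pow (norm_nonneg _)]
  -- sum the squares: Young
  have hsq : eNormSq 0 (wmul (-(σ : ℝ)) (conv a g) - conv a (wmul (-(σ : ℝ)) g)) ≤
      ENNReal.ofReal C ^ 2 * (symbNorm ((σ : ℝ) + 2) a ^ 2 * eNormSq (-(σ : ℝ) - 1) g) := by
    calc eNormSq 0 _ = ∑' k, ‖(wmul (-(σ : ℝ)) (conv a g) - conv a (wmul (-(σ : ℝ)) g)) k‖ₑ ^ 2 := by
          simp [eNormSq]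
      _ ≤ ∑' k, (ENNReal.ofReal C * ∑' l, α (k - l) * β l) ^ 2 := ENNReal.tsum_le_tsum fun k => by
          gcongr; exact hterm k
      _ = ENNReal.ofReal C ^ 2 * ∑' k, (∑' l, α (k - l) * β l) ^ 2 := by
          simp only [mul_pow]; exact ENNReal.tsum_mul_left
      _ ≤ ENNReal.ofReal C ^ 2 * ((∑' k, α k) ^ 2 * ∑' l, β l ^ 2) := by gcongr; exact young_sq α β
      _ = _ := by rw [hαsum, hβsum]
  calc eNorm 0 _ = (eNormSq 0 (wmul (-(σ : ℝ)) (conv a g) - conv a (wmul (-(σ : ℝ)) g))) ^ (1 / 2 : ℝ) := rfl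
    _ ≤ (ENNReal.ofReal C ^ 2 * (symbNorm ((σ : ℝ) + 2) a ^ 2 * eNormSq (-(σ : ℝ) - 1) g)) ^ (1 / 2 : ℝ) := by
        gcongr
    _ = ENNReal.ofReal C * symbNorm ((σ : ℝ) + 2) a * eNorm (-(σ : ℝ) - 1) g := by
        rw [ENNReal.mul_rpow_of_nonneg _ _ (by norm_num), ENNReal.mul_rpow_of_nonneg _ _ (by norm_num),
          ennreal_sq_rpow_half, ennreal_sq_rpow_half, eNorm, mul_assoc]

/-- **Transfer of an `H_0` operator bound to negative levels** (Warner 6.18 (i), (6) for `s < 0`):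
if the multiplier `a ⋆ ·` satisfies `‖a ⋆ c‖_0 ≤ ε ‖c‖_0` for all `c ∈ H_0` (on the torus:
`‖ω‖_∞ ≤ ε`), then for `σ ∈ ℕ` and tempered `g ∈ H_{-σ}`,
`‖a ⋆ g‖_{-σ} ≤ ε ‖g‖_{-σ} + σ 2^{(σ+1)/2} A_{σ+2}(a) ‖g‖_{-σ-1}`.
[cite: WarnerGTM94, 6.18 (i)] -/
theorem eNorm_conv_le_of_level_zero [CompleteSpace W] {a : (d → ℤ) → (V →L[ℂ] W)}
    (ha : RapidDecay a) {ε : ℝ≥0∞}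
    (hε : ∀ c : (d → ℤ) → V, eNormSq 0 c < ∞ → eNorm 0 (conv a c) ≤ ε * eNorm 0 c)
    (σ : ℕ) {g : (d → ℤ) → V} (hg : eNormSq (-(σ : ℝ)) g < ∞) :
    eNorm (-(σ : ℝ)) (conv a g) ≤ ε * eNorm (-(σ : ℝ)) g +
      ENNReal.ofReal (σ * (2 : ℝ) ^ (((σ : ℝ) + 1) / 2)) * symbNorm ((σ : ℝ) + 2) a *
        eNorm (-(σ : ℝ) - 1) g := by
  have hgt : Tempered g := ⟨_, hg⟩
  have h0 : eNormSq 0 (wmul (-(σ : ℝ)) g) < ∞ := by rwa [eNormSq_wmul, zero_add]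
  calc eNorm (-(σ : ℝ)) (conv a g) = eNorm 0 (wmul (-(σ : ℝ)) (conv a g)) := by rw [eNorm_wmul, zero_add]
    _ = eNorm 0 (conv a (wmul (-(σ : ℝ)) g) + (wmul (-(σ : ℝ)) (conv a g) - conv a (wmul (-(σ : ℝ)) g))) := by
        rw [add_sub_cancel]
    _ ≤ eNorm 0 (conv a (wmul (-(σ : ℝ)) g)) + eNorm 0 (wmul (-(σ : ℝ)) (conv a g) - conv a (wmul (-(σ : ℝ)) g)) :=
        eNorm_add_le 0 _ _
    _ ≤ ε * eNorm 0 (wmul (-(σ : ℝ)) g) + _ := add_le_add (hε _ h0) (eNorm_wmul_conv_sub_le ha hgt σ)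
    _ = _ := by rw [eNorm_wmul, zero_add]

/-! ### Peter–Paul (Warner 6.18 (g)) -/

omit [NormedSpace ℂ V] in
/-- **Peter–Paul inequality** (Warner (1983), 6.18 (g)), lattice form between three consecutive
levels: `‖c‖²_{s+1} ≤ δ ‖c‖²_{s+2} + (4δ)⁻¹ ‖c‖²_s` for every `δ > 0`
(termwise `y ≤ δ y² + (4δ)⁻¹` for `y = 1 + |k|²`). [cite: WarnerGTM94, 6.18 (g)] -/
theorem eNormSq_add_one_le_peterPaul (s : ℝ) {δ : ℝ} (hδ : 0 < δ) (c : (d → ℤ) → V) :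
    eNormSq (s + 1) c ≤ ENNReal.ofReal δ * eNormSq (s + 2) c + ENNReal.ofReal (4 * δ)⁻¹ * eNormSq s c := by
  rw [eNormSq, eNormSq, eNormSq, ← ENNReal.tsum_mul_left, ← ENNReal.tsum_mul_left, ← ENNReal.tsum_add]
  refine ENNReal.tsum_le_tsum fun k => ?_
  have hpos : 0 < 1 + freqNormSq k := by linarith [freqNormSq_nonneg k]
  -- `y ≤ δ y² + (4δ)⁻¹` since `δ y² - y + (4δ)⁻¹ = δ (y - (2δ)⁻¹)²`
  have hy : (1 + freqNormSq k) ≤ δ * (1 + freqNormSq k) ^ 2 + (4 * δ)⁻¹ := by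
    have hsq : 0 ≤ δ * ((1 + freqNormSq k) - (2 * δ)⁻¹) ^ 2 := by positivity
    have key : δ * ((1 + freqNormSq k) - (2 * δ)⁻¹) ^ 2 =
        δ * (1 + freqNormSq k) ^ 2 + (4 * δ)⁻¹ - (1 + freqNormSq k) := by
      field_simp
      ring
    rw [key] at hsq
    linarith
  have hw : sobolevWeight (s + 1) k ^ 2 ≤ δ * sobolevWeight (s + 2) k ^ 2 + (4 * δ)⁻¹ * sobolevWeight s k ^ 2 := by
    rw [sobolevWeight_add s 1, sobolevWeight_add s 2, mul_pow, mul_pow, sobolevWeight_one_sq, sobolevWeight_sq 2,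
      Real.rpow_two]
    have hs := sq_nonneg (sobolevWeight s k)
    nlinarith [mul_le_mul_of_nonneg_left hy hs]
  calc ENNReal.ofReal (sobolevWeight (s + 1) k ^ 2) * ‖c k‖ₑ ^ 2
      ≤ ENNReal.ofReal (δ * sobolevWeight (s + 2) k ^ 2 + (4 * δ)⁻¹ * sobolevWeight s k ^ 2) * ‖c k‖ₑ ^ 2 := by
        gcongr
    _ = _ := by
        rw [ENNReal.ofReal_add (by positivity) (by positivity), ENNReal.ofReal_mul hδ.le,
          ENNReal.ofReal_mul (by positivity), ENNReal.ofReal_inv_of_pos (by positivity)]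
        ring

end Lattice

end Literature.Analysis.FunctionSpaces
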